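import Summits.ValiantsHypothesis.ValiantsHypothesis.Theorems.DefinabilityGapUnitRigidity
import HarnessLib

/-!
# DefinabilityGap — LABEL SUPPORT, stage E2: the prime-generic engine and mixed chains

Route `route-ValiantsHypothesis-DefinabilityGap` (DRAFT), read-once leaf F4 / W10 (aside `KIPlantedHittingRO`,
stmt-ValiantsHypothesis-23704), leaf `ZperHits₂(m)` = hypothesis `hZ` of
`DefinabilityGapZperTransfer.chainVal_eq_zero_of_bind₁_kiPer` (decomp-valiant bus, OFFER O-L5-LS l.1198 /
CALL l.1209, series E1 / E2 / E3 with the prime-generic option; this is E2, independent of E1).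

THE ENGINE, PRIME-GENERIC. S1a / S1b / S2 (`DefinabilityGapUnitRigidity*`) ran the top-form walk with the prime
`per_m`. Here the prime is a parameter: `Q ∈ K[σ]` prime with the KEY property
`∀ f ∈ locSpan c, f ≠ 0 → Q ∤ topForm f` (for `Q = per_m` this is `not_perPoly_dvd_topForm`, `c < m`; for the
zero-pattern permanent `Q_S` of E1 it is proved in E3). Verbatim transcriptions of S1a's `walk_step`, S1b's `walk` /
`wmat_zero_one_eq_zero` and S2's `chainVal_eq_zero_of_isUnit_det` with `per_m ↦ Q`, and with the divisibility
hypothesis moved to the TOP FORM (`Q ∣ topForm f`), which is what an inhomogeneous specialisation of `per_m` with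
top form `Q` delivers (E3) — no homogeneity of `Q` is needed.

MIXED CHAINS (new on this leaf). A width-2 chain whose links are EITHER unit univariate-image links
`M(ℓ)` (`M ∈ GL₂(K[t])`, `|vars ℓ| ≤ c`) OR arbitrary CONSTANT matrices `N₀ ∈ K^{2×2}` (possibly singular) and
whose value has top form divisible by `Q` vanishes (`chainVal_eq_zero_of_prime`): a non-singular constant link is
a word of constant letters (Cohn), a singular one has rank `≤ 1`, `N₀ = p qᵀ`, and CUTS the chain,
`uᵀ L₁ (p qᵀ) L₂ v = (uᵀ L₁ p) · (qᵀ L₂ v)` (`chainVal_append_cons_rank_one`); `Q` prime divides the top form of a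
factor; strong induction on the length. Instance `chainVal_eq_zero_of_perPoly_mixed` (`Q = per_m`, `c < m`):
S2 extended by constant singular links.

HONEST GRADE (critic, l.1209): KNOWN ingredients (Allender–Wang 2016 / Bringmann–Ikenmeyer–Zuiddam JACM 2018
Def 5.5–Thm 5.6 indg mechanism as in S1a–S2; Cohn 1966 `GE₂`; rank-one cuts); NEW COMBINATION on this leaf;
kernel-new; a lemma for E3; closes no item; 0 S-currency; rung 0; VP ≠ VNP untouched. No facts, no Prop-valued
definitions, no placeholders, no new data definitions.
-/

set_option linter.dupNamespace false

open MvPolynomial Finset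
open Literature.Computability.AlgebraicComplexity
open Summit.ValiantsHypothesis.ValiantsHypothesis.Theorems.DefinabilityGapUnitRigidityForms
open Summit.ValiantsHypothesis.ValiantsHypothesis.Theorems.DefinabilityGapUnitRigidityWords
open Summit.ValiantsHypothesis.ValiantsHypothesis.Theorems.DefinabilityGapZperTransfer
open Summit.ValiantsHypothesis.ValiantsHypothesis.Theorems.DefinabilityGapUnitRigidity

namespace Summit.ValiantsHypothesis.ValiantsHypothesis.Theorems.DefinabilityGapPrimeRigidity

variable {K : Type*} [Field K] {σ : Type*} {c : ℕ} {Q : MvPolynomial σ K}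

/-! ## 1. The top-form walk for a generic prime `Q` with the KEY property -/

section Walk

/-- KEY on constants: `Q ∤ C a` for `a ≠ 0`. [this file] -/
theorem not_dvd_C_of_key (hKEY : ∀ f ∈ locSpan K σ c, f ≠ 0 → ¬ Q ∣ topForm f) {a : K} (ha : a ≠ 0) :
    ¬ Q ∣ (C a : MvPolynomial σ K) := by
  have h := hKEY (C a) (C_mem_locSpan c a) (mt C_eq_zero.1 ha)
  rwa [topForm_C] at h

/-- The top form of a homogeneous non-zero polynomial is itself. [this file] -/
theorem topForm_eq_self_of_isHomogeneous {φ : MvPolynomial σ K} {n : ℕ} (hφ : φ.IsHomogeneous n)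
    (h0 : φ ≠ 0) : topForm φ = φ := by
  unfold topForm
  rw [hφ.totalDegree h0, homogeneousComponent_of_mem ((mem_homogeneousSubmodule n φ).2 hφ), if_pos rfl]

/-- ONE STEP OF THE ROW WALK `(x, y) ↦ (x a - y, x)` for a generic prime `Q` (S1a `walk_step` with
`per_m ↦ Q`): the invariant `x ≠ 0 ∧ Q ∤ topForm x ∧ deg y ≤ deg x` survives a non-constant step `a` with
`Q ∤ topForm a`. [this file] -/
theorem walk_step_of_prime (hQ : Prime Q) {x y a : MvPolynomial σ K} (hx : x ≠ 0)
    (hxP : ¬ Q ∣ topForm x) (hyx : y.totalDegree ≤ x.totalDegree) (ha0 : a ≠ 0)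
    (ha1 : a.totalDegree ≠ 0) (haP : ¬ Q ∣ topForm a) :
    x * a - y ≠ 0 ∧ ¬ Q ∣ topForm (x * a - y) ∧ x.totalDegree ≤ (x * a - y).totalDegree := by
  have hdeg : (x * a).totalDegree = x.totalDegree + a.totalDegree := totalDegree_mul_of_isDomain hx ha0
  have hlt : y.totalDegree < (x * a).totalDegree := by omega
  have hd2 : (x * a - y).totalDegree = (x * a).totalDegree := totalDegree_sub_of_lt hlt
  refine ⟨fun h0 => ?_, ?_, by omega⟩
  · rw [h0, totalDegree_zero] at hd2
    omega
  · rw [topForm_sub_of_lt hlt, topForm_mul hx ha0]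
    exact fun hd => (hQ.dvd_or_dvd hd).elim hxP haP

/-- THE ROW WALK along `eprod t` for a generic prime `Q` (S1b `walk` with `per_m ↦ Q`): all letters `c`-local
and non-constant; row `0` of `N · eprod t` stays in state `J` (`x ≠ 0`, `Q ∤ topForm x`, `deg y ≤ deg x`) or
`Z` (`(0, 1)`). [this file] -/
theorem walk_of_prime (hQ : Prime Q) (hKEY : ∀ f ∈ locSpan K σ c, f ≠ 0 → ¬ Q ∣ topForm f)
    (N : Matrix (Fin 2) (Fin 2) (MvPolynomial σ K)) (t : List (MvPolynomial σ K))
    (ht : ∀ z ∈ t, z ∈ locSpan K σ c ∧ z.totalDegree ≠ 0)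
    (hN : (N 0 0 ≠ 0 ∧ ¬ Q ∣ topForm (N 0 0) ∧ (N 0 1).totalDegree ≤ (N 0 0).totalDegree) ∨
      (N 0 0 = 0 ∧ N 0 1 = 1)) :
    ((N * eprod t) 0 0 ≠ 0 ∧ ¬ Q ∣ topForm ((N * eprod t) 0 0) ∧
        ((N * eprod t) 0 1).totalDegree ≤ ((N * eprod t) 0 0).totalDegree) ∨
      ((N * eprod t) 0 0 = 0 ∧ (N * eprod t) 0 1 = 1) := by
  induction t with
  | nil => simpa using hN
  | cons z t ih =>
    obtain ⟨hzL, hz1⟩ := ht z (by simp)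
    have hz0 : z ≠ 0 := fun h => hz1 (by rw [h, totalDegree_zero])
    have hzP := hKEY z hzL hz0
    have h00 := (mul_eM_apply (N * eprod t) z).1
    have h01 := (mul_eM_apply (N * eprod t) z).2
    simp only [eprod_cons, ← Matrix.mul_assoc]
    rw [h00, h01]
    rcases ih (fun y hy => ht y (List.mem_cons_of_mem _ hy)) with ⟨hx, hxP, hyx⟩ | ⟨hx, hy⟩
    · exact Or.inl (walk_step_of_prime hQ hx hxP hyx hz0 hz1 hzP)
    · refine Or.inl ⟨?_, ?_, ?_⟩
      · rw [hx, hy, zero_mul, zero_sub]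
        exact neg_ne_zero.2 one_ne_zero
      · rw [hx, hy, zero_mul, zero_sub, show (-1 : MvPolynomial σ K) = C (-1) by rw [map_neg, C_1],
          topForm_C]
        exact not_dvd_C_of_key hKEY (neg_ne_zero.2 one_ne_zero)
      · rw [hx, totalDegree_zero]
        exact Nat.zero_le _

/-- PRIME RIGIDITY FOR WORDS (S1b `wmat_zero_one_eq_zero` with `per_m ↦ Q`, divisibility on the top form):
every word `w` of `c`-local letters with non-zero scalars satisfies `Q ∣ topForm (wmat w)₀₁ ⇒ (wmat w)₀₁ = 0`.
[this file] -/
theorem wmat_zero_one_eq_zero_of_prime (hQ : Prime Q) (hKEY : ∀ f ∈ locSpan K σ c, f ≠ 0 → ¬ Q ∣ topForm f)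
    (w : List (MvPolynomial σ K × K × K)) (hw : ∀ t ∈ w, t.1 ∈ locSpan K σ c ∧ t.2.1 ≠ 0 ∧ t.2.2 ≠ 0)
    (hdvd : Q ∣ topForm (wmat K w 0 1)) : wmat K w 0 1 = 0 := by
  rcases exists_std w hw with rfl | ⟨α, β, b, rest, hα, -, hb, hrest, htail, hW⟩
  · rw [wmat_nil]
    exact Matrix.one_apply_ne (by decide)
  have hCα : (C α : MvPolynomial σ K) ≠ 0 := mt C_eq_zero.1 hα
  rcases rest with _ | ⟨z, t⟩
  · exfalso
    rw [hW, Matrix.mul_assoc, dmat_mul_apply, eprod_nil, Matrix.mul_one, (eM_apply b).2, mul_one,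
      topForm_C] at hdvd
    exact not_dvd_C_of_key hKEY hα hdvd
  · have h01 : wmat K w 0 1 = C α * (eM b * eprod t) 0 0 := by
      rw [hW, eprod_cons, ← Matrix.mul_assoc, (mul_eM_apply _ _).2, Matrix.mul_assoc, dmat_mul_apply]
    have hstart : (eM b 0 0 ≠ 0 ∧ ¬ Q ∣ topForm (eM b 0 0) ∧
        (eM b 0 1).totalDegree ≤ (eM b 0 0).totalDegree) ∨ (eM b 0 0 = 0 ∧ eM b 0 1 = 1) := by
      rw [(eM_apply b).1, (eM_apply b).2]
      by_cases hb0 : b = 0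
      · exact Or.inr ⟨hb0, rfl⟩
      · refine Or.inl ⟨hb0, hKEY b hb hb0, ?_⟩
        rw [totalDegree_one]
        exact Nat.zero_le _
    rcases walk_of_prime hQ hKEY (eM b) t (fun z hz => ⟨hrest z (List.mem_cons_of_mem _ hz), htail z hz⟩)
      hstart with ⟨hx, hxP, -⟩ | ⟨hx, -⟩
    · exfalso
      rw [h01, topForm_mul hCα hx, topForm_C] at hdvd
      rcases hQ.dvd_or_dvd hdvd with h | h
      · exact not_dvd_C_of_key hKEY hα h
      · exact hxP h
    · rw [h01, hx, mul_zero]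

/-- PRIME RIGIDITY FOR CHAINS OF UNIT LINKS (S2 `chainVal_eq_zero_of_isUnit_det` with `per_m ↦ Q`): a width-2
chain of unit univariate-image links with `c`-local arguments whose value has top form divisible by `Q` is zero.
[this file] -/
theorem chainVal_eq_zero_of_unit_links (hQ : Prime Q)
    (hKEY : ∀ f ∈ locSpan K σ c, f ≠ 0 → ¬ Q ∣ topForm f)
    (l : List (Matrix (Fin 2) (Fin 2) (Polynomial K) × MvPolynomial σ K))
    (hloc : ∀ e ∈ l, ∃ T : Finset σ, T.card ≤ c ∧ e.2.vars ⊆ T) (hunit : ∀ e ∈ l, IsUnit e.1.det)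
    (u v : Fin 2 → K) (h : Q ∣ topForm (chainVal (l.map ulink) u v)) : chainVal (l.map ulink) u v = 0 := by
  by_cases hu : u = 0
  · subst hu
    simp [chainVal]
  by_cases hv : v = 0
  · subst hv
    simp [chainVal, Matrix.mulVec, dotProduct]
  obtain ⟨U, hU, hUrow⟩ := exists_row_word σ c u hu
  obtain ⟨V, hV, hVcol⟩ := exists_col_word σ c v hv
  obtain ⟨w, hw, hwl⟩ := exists_word_links l hloc hunit
  have hentry : wmat K (U ++ w ++ V) 0 1 = chainVal (l.map ulink) u v := by
    rw [wmat_append, wmat_append, hwl]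
    exact entry_eq_chainVal _ _ _ u v hUrow hVcol
  have hT : ∀ t ∈ U ++ w ++ V, t.1 ∈ locSpan K σ c ∧ t.2.1 ≠ 0 ∧ t.2.2 ≠ 0 := by
    intro t ht
    simp only [List.mem_append] at ht
    rcases ht with (ht | ht) | ht
    exacts [hU t ht, hw t ht, hV t ht]
  rw [← hentry] at h ⊢
  exact wmat_zero_one_eq_zero_of_prime hQ hKEY (U ++ w ++ V) hT h

end Walk

/-! ## 2. Constant links: words if non-singular, rank-one cuts if singular -/

section Links

/-- A constant matrix is the univariate-image link `(N₀, 0)` with constant entries. [this file] -/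
theorem ulink_map_C (N₀ : Matrix (Fin 2) (Fin 2) K) :
    ulink (N₀.map Polynomial.C, (0 : MvPolynomial σ K)) = N₀.map C := by
  ext i k
  simp [ulink, Matrix.map_apply, Polynomial.aeval_C, MvPolynomial.algebraMap_eq]

/-- A non-singular constant matrix is a unit link. [this file] -/
theorem isUnit_det_map_C {N₀ : Matrix (Fin 2) (Fin 2) K} (h : N₀.det ≠ 0) :
    IsUnit (N₀.map Polynomial.C).det := by
  rw [← RingHom.mapMatrix_apply, ← RingHom.map_det]
  exact (IsUnit.mk0 _ h).map _

/-- Choosing a link for every matrix of a list. [this file] -/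
theorem exists_links_of_forall {P : Matrix (Fin 2) (Fin 2) (Polynomial K) × MvPolynomial σ K → Prop}
    {L : List (Matrix (Fin 2) (Fin 2) (MvPolynomial σ K))} (h : ∀ N ∈ L, ∃ e, P e ∧ ulink e = N) :
    ∃ l : List (Matrix (Fin 2) (Fin 2) (Polynomial K) × MvPolynomial σ K),
      (∀ e ∈ l, P e) ∧ l.map ulink = L := by
  induction L with
  | nil => exact ⟨[], fun e he => by simp at he, rfl⟩
  | cons N L ih =>
    obtain ⟨l, hl, hlL⟩ := ih fun N' hN' => h N' (List.mem_cons_of_mem _ hN')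
    obtain ⟨e, he, heN⟩ := h N (by simp)
    refine ⟨e :: l, fun e' he' => ?_, by rw [List.map_cons, heN, hlL]⟩
    rcases List.mem_cons.1 he' with rfl | he'
    exacts [he, hl e' he']

/-- A singular `2 × 2` matrix over a field has rank `≤ 1`: `N₀ = p qᵀ`. [this file] -/
theorem exists_rank_one_of_det_eq_zero (N₀ : Matrix (Fin 2) (Fin 2) K) (h : N₀.det = 0) :
    ∃ p q : Fin 2 → K, ∀ i k, N₀ i k = p i * q k := by
  rw [Matrix.det_fin_two] at h
  by_cases h00 : N₀ 0 0 = 0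
  · rw [h00, zero_mul, zero_sub, neg_eq_zero, mul_eq_zero] at h
    rcases h with h01 | h10
    · refine ⟨![0, 1], fun k => N₀ 1 k, fun i k => ?_⟩
      fin_cases i <;> fin_cases k <;> simp [h00, h01]
    · refine ⟨fun i => N₀ i 1, ![0, 1], fun i k => ?_⟩
      fin_cases i <;> fin_cases k <;> simp [h00, h10]
  · refine ⟨![1, N₀ 1 0 / N₀ 0 0], fun k => N₀ 0 k, fun i k => ?_⟩
    fin_cases i <;> fin_cases k
    · show N₀ 0 0 = 1 * N₀ 0 0
      rw [one_mul]
    · show N₀ 0 1 = 1 * N₀ 0 1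
      rw [one_mul]
    · show N₀ 1 0 = N₀ 1 0 / N₀ 0 0 * N₀ 0 0
      rw [div_mul_cancel₀ _ h00]
    · show N₀ 1 1 = N₀ 1 0 / N₀ 0 0 * N₀ 0 1
      rw [div_mul_eq_mul_div, eq_div_iff h00]
      linear_combination h

/-- THE RANK-ONE CUT: `uᵀ · L₁ · (p qᵀ) · L₂ · v = (uᵀ L₁ p) · (qᵀ L₂ v)`. [this file] -/
theorem chainVal_append_cons_rank_one (L₁ L₂ : List (Matrix (Fin 2) (Fin 2) (MvPolynomial σ K)))
    {N₀ : Matrix (Fin 2) (Fin 2) K} {p q : Fin 2 → K} (hN : ∀ i k, N₀ i k = p i * q k) (u v : Fin 2 → K) :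
    chainVal (L₁ ++ N₀.map C :: L₂) u v = chainVal L₁ u p * chainVal L₂ q v := by
  simp only [chainVal, List.prod_append, List.prod_cons, ← Matrix.mulVec_mulVec]
  simp only [Matrix.mulVec, dotProduct, Fin.sum_univ_two, Matrix.map_apply, hN, map_mul]
  ring

end Links

/-! ## 3. Mixed chains: unit `c`-local links and constant links -/

section Mixed

/-- PRIME RIGIDITY FOR MIXED CHAINS (lists of length `< n`; strong induction with rank-one cuts). [this file] -/
theorem chainVal_eq_zero_of_prime_aux (hQ : Prime Q) (hKEY : ∀ f ∈ locSpan K σ c, f ≠ 0 → ¬ Q ∣ topForm f) :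
    ∀ (n : ℕ) (L : List (Matrix (Fin 2) (Fin 2) (MvPolynomial σ K))), L.length < n →
      (∀ N ∈ L, (∃ e : Matrix (Fin 2) (Fin 2) (Polynomial K) × MvPolynomial σ K,
          IsUnit e.1.det ∧ (∃ T : Finset σ, T.card ≤ c ∧ e.2.vars ⊆ T) ∧ ulink e = N) ∨
        ∃ N₀ : Matrix (Fin 2) (Fin 2) K, N₀.map C = N) →
      ∀ u v : Fin 2 → K, Q ∣ topForm (chainVal L u v) → chainVal L u v = 0 := by
  intro n
  induction n with
  | zero => exact fun L hL => absurd hL (Nat.not_lt_zero _)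
  | succ n ih =>
    intro L hLn hL u v hdvd
    by_cases hsing : ∃ N ∈ L, ∃ N₀ : Matrix (Fin 2) (Fin 2) K, N₀.map C = N ∧ N₀.det = 0
    · -- a singular constant link cuts the chain into two shorter mixed chains
      obtain ⟨N, hN, N₀, rfl, hdet⟩ := hsing
      obtain ⟨L₁, L₂, rfl⟩ := List.append_of_mem hN
      obtain ⟨p, q, hpq⟩ := exists_rank_one_of_det_eq_zero N₀ hdet
      have hL₁ : L₁.length < n := by
        rw [List.length_append, List.length_cons] at hLn
        omega
      have hL₂ : L₂.length < n := by
        rw [List.length_append, List.length_cons] at hLn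
        omega
      rw [chainVal_append_cons_rank_one L₁ L₂ hpq u v] at hdvd ⊢
      by_cases h₁ : chainVal L₁ u p = 0
      · rw [h₁, zero_mul]
      by_cases h₂ : chainVal L₂ q v = 0
      · rw [h₂, mul_zero]
      exfalso
      rw [topForm_mul h₁ h₂] at hdvd
      rcases hQ.dvd_or_dvd hdvd with hd | hd
      · exact h₁ (ih L₁ hL₁ (fun N hN => hL N (List.mem_append.2 (Or.inl hN))) u p hd)
      · exact h₂ (ih L₂ hL₂ (fun N hN => hL N (List.mem_append.2 (Or.inr (List.mem_cons_of_mem _ hN))))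
          q v hd)
    · -- every link is a unit link (non-singular constant links are constant unit links)
      push Not at hsing
      have hL' : ∀ N ∈ L, ∃ e : Matrix (Fin 2) (Fin 2) (Polynomial K) × MvPolynomial σ K,
          (IsUnit e.1.det ∧ ∃ T : Finset σ, T.card ≤ c ∧ e.2.vars ⊆ T) ∧ ulink e = N := by
        intro N hN
        rcases hL N hN with ⟨e, hu, hT, he⟩ | ⟨N₀, rfl⟩
        · exact ⟨e, ⟨hu, hT⟩, he⟩
        · exact ⟨(N₀.map Polynomial.C, 0), ⟨isUnit_det_map_C (hsing _ hN N₀ rfl), ∅, by simp,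
            by simp⟩, ulink_map_C N₀⟩
      obtain ⟨l, hl, rfl⟩ := exists_links_of_forall hL'
      exact chainVal_eq_zero_of_unit_links hQ hKEY l (fun e he => (hl e he).2) (fun e he => (hl e he).1)
        u v hdvd

/-- **PRIME RIGIDITY FOR MIXED CHAINS.** `Q ∈ K[σ]` prime with the KEY property
`∀ f ∈ locSpan c, f ≠ 0 → Q ∤ topForm f`; `L` a width-2 chain each of whose links is EITHER a unit
univariate-image link `M(ℓ)` (`IsUnit M.det`, `|vars ℓ| ≤ c`) OR a constant matrix `N₀ ∈ K^{2×2}` (possibly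
singular). If `Q` divides the top form of the chain value `uᵀ L v`, the chain value is `0` — any length.
[this file] -/
theorem chainVal_eq_zero_of_prime (hQ : Prime Q) (hKEY : ∀ f ∈ locSpan K σ c, f ≠ 0 → ¬ Q ∣ topForm f)
    (L : List (Matrix (Fin 2) (Fin 2) (MvPolynomial σ K)))
    (hL : ∀ N ∈ L, (∃ e : Matrix (Fin 2) (Fin 2) (Polynomial K) × MvPolynomial σ K,
        IsUnit e.1.det ∧ (∃ T : Finset σ, T.card ≤ c ∧ e.2.vars ⊆ T) ∧ ulink e = N) ∨
      ∃ N₀ : Matrix (Fin 2) (Fin 2) K, N₀.map C = N)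
    (u v : Fin 2 → K) (h : Q ∣ topForm (chainVal L u v)) : chainVal L u v = 0 :=
  chainVal_eq_zero_of_prime_aux hQ hKEY (L.length + 1) L (Nat.lt_succ_self _) hL u v h

/-- The divisibility form: if the chain value is `P · G` with `Q ∣ topForm P` (e.g. `P` an inhomogeneous
specialisation of `per_m` with top form `Q`, as in E3; or `P = Q` homogeneous), it vanishes. [this file] -/
theorem chainVal_eq_zero_of_prime_of_eq_mul (hQ : Prime Q)
    (hKEY : ∀ f ∈ locSpan K σ c, f ≠ 0 → ¬ Q ∣ topForm f) {P : MvPolynomial σ K} (hP : Q ∣ topForm P)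
    (L : List (Matrix (Fin 2) (Fin 2) (MvPolynomial σ K)))
    (hL : ∀ N ∈ L, (∃ e : Matrix (Fin 2) (Fin 2) (Polynomial K) × MvPolynomial σ K,
        IsUnit e.1.det ∧ (∃ T : Finset σ, T.card ≤ c ∧ e.2.vars ⊆ T) ∧ ulink e = N) ∨
      ∃ N₀ : Matrix (Fin 2) (Fin 2) K, N₀.map C = N)
    (u v : Fin 2 → K) (G : MvPolynomial σ K) (h : chainVal L u v = P * G) : chainVal L u v = 0 := by
  by_cases hG : G = 0
  · rw [h, hG, mul_zero]
  by_cases hP0 : P = 0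
  · rw [h, hP0, zero_mul]
  refine chainVal_eq_zero_of_prime hQ hKEY L hL u v ?_
  rw [h, topForm_mul hP0 hG]
  exact dvd_mul_of_dvd_left hP _

/-- INSTANCE `Q = per_m` (`c < m`): UNIT RIGIDITY (S2) extended to chains that also contain arbitrary constant
links, in particular SINGULAR ones — `per_m ∣ uᵀ L v ⇒ uᵀ L v = 0`. [this file] -/
theorem chainVal_eq_zero_of_perPoly_mixed {m c : ℕ} (hcm : c < m)
    (L : List (Matrix (Fin 2) (Fin 2) (MvPolynomial (Fin m × Fin m) K)))
    (hL : ∀ N ∈ L, (∃ e : Matrix (Fin 2) (Fin 2) (Polynomial K) × MvPolynomial (Fin m × Fin m) K,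
        IsUnit e.1.det ∧ (∃ T : Finset (Fin m × Fin m), T.card ≤ c ∧ e.2.vars ⊆ T) ∧ ulink e = N) ∨
      ∃ N₀ : Matrix (Fin 2) (Fin 2) K, N₀.map C = N)
    (u v : Fin 2 → K) (H : MvPolynomial (Fin m × Fin m) K) (h : chainVal L u v = perPoly (Fin m) K * H) :
    chainVal L u v = 0 := by
  have hm : 0 < m := by omega
  haveI : Nonempty (Fin m) := ⟨⟨0, hm⟩⟩
  refine chainVal_eq_zero_of_prime_of_eq_mul (perPoly_prime hm)
    (fun f hf h0 => not_perPoly_dvd_topForm hcm hf h0) ?_ L hL u v H h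
  rw [topForm_eq_self_of_isHomogeneous (perPoly_isHomogeneous (n := Fin m) (k := K))
    (perPoly_prime hm).ne_zero]

end Mixed

end Summit.ValiantsHypothesis.ValiantsHypothesis.Theorems.DefinabilityGapPrimeRigidity
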